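import Summits.ResolutionOfSingularities.ResolutionOfSingularities.Theorems.FrobeniusClosingNoPeriodicIsolatedAtomUnwindOfTransport
import Summits.ResolutionOfSingularities.ResolutionOfSingularities.Theorems.FrobeniusClosingClosingReductionTransport
import Summits.ResolutionOfSingularities.ResolutionOfSingularities.Theorems.WildConesConeExit

/-!
# `NoPeriodicIsolatedAtom` from the WildCones engine and successor transport
# (crux stmt-ResolutionOfSingularities-16344, line `ridge_rank`, lead; Theorems-side assembly)

With the one-step cone exit lemma `WildCones.ConeExit` now a THEOREM (`ConeExit_proof`, crux 16883
closed 2026-08-17), the crux `FrobeniusClosing.NoPeriodicIsolatedAtom` follows from three named sibling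
statements, all stated in the tree and all under proof by their own lines:

* `Transport` (crux `ClosingReduction`, line `chart-factorization`, `Theorems/FrobeniusClosingDefs.lean`):
  successor points transport along pair isomorphisms — it unwinds the periodic chain to an eternal
  isolated multiplicity-`p` chain over the same, perfect, field (`unwind_of_transport`, landed);
* `WildCones.ClassicalRegimes` (crux 16884): no eternal isolated chain for `n ≤ 2 ∨ p = 2`;
* `WildCones.NarrowRunsDie` (crux 16882): no eternal isolated ridge chain of invariance rank `1` for
  `p` odd, `n ≥ 3` — and `ConeExit` at every step of an eternal isolated chain puts every state on the
  ridge with rank `1`.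

`noPeriodicIsolatedAtom_of_engine : Transport → NarrowRunsDie → ClassicalRegimes → NoPeriodicIsolatedAtom`
is that assembly, kernel-checked; the route files' `let`-calculi and `Theorems/FrobeniusClosingDefs.lean`
agree definitionally, so the sibling decls are applied as they stand. Since `Transport` is itself landed
(`stub_transport stub_pairIsoKit`), `noPeriodicIsolatedAtom_of_wildCones : NarrowRunsDie → ClassicalRegimes →
NoPeriodicIsolatedAtom` is the crux modulo the two remaining WildCones cruxes.
-/

noncomputable section

-- single-problem summit: the doubled namespace component is forced by the tree layout
set_option linter.dupNamespace false

namespace Summit.ResolutionOfSingularities.ResolutionOfSingularities.Theorems.FrobeniusClosing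

open Summit.ResolutionOfSingularities.ResolutionOfSingularities.Theses.FrobeniusClosing (NoPeriodicIsolatedAtom)
open Summit.ResolutionOfSingularities.ResolutionOfSingularities.Theses.WildCones (NarrowRunsDie ClassicalRegimes ConeExit)

/-- **Registered helper goal `noPeriodicIsolatedAtom_of_engine`** — the crux `NoPeriodicIsolatedAtom`
from successor transport and the two remaining WildCones cruxes (the cone exit lemma being a theorem):
unwind to an eternal isolated multiplicity-`p` chain over the same perfect field of characteristic `p`;
the classical regimes `n ≤ 2 ∨ p = 2` are excluded by `ClassicalRegimes`; otherwise `ConeExit` at every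
step gives cleaned order `p` and invariance rank `1` for every state, excluded by `NarrowRunsDie`.
[cite: HauserPerlega2019, §1 p. 3 and §5] -/
theorem noPeriodicIsolatedAtom_of_engine :
    Transport → NarrowRunsDie → ClassicalRegimes → NoPeriodicIsolatedAtom := by
  intro hT hN hC
  refine noPeriodicIsolatedAtom_iff.mpr ?_
  intro p hp n hn κ _ _ _ c₀ i t r hr hchain hiso
  obtain ⟨hchar, hperf, c₁, i₁, t₁, hall⟩ := unwind_of_transport hT p hp n hn κ c₀ i t r hr hchain hiso
  haveI : CharP κ p := hchar
  haveI : PerfectField κ := hperf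
  by_cases hcl : n ≤ 2 ∨ p = 2
  · exact hC p hp n hn hcl κ c₁ i₁ t₁ hall
  · have hn3 : 3 ≤ n := by
      rcases Nat.lt_or_ge n 3 with h | h
      · exact absurd (Or.inl (by omega)) hcl
      · exact h
    have hp2 : p ≠ 2 := fun h => hcl (Or.inr h)
    have hCE := fun m =>
      Summit.ResolutionOfSingularities.ResolutionOfSingularities.Theorems.WildConesConeExit.ConeExit_proof
        p hp hp2 n hn3 κ (run p n κ c₁ i₁ t₁ m) (i₁ m) (t₁ m)
        (hall m).1 (hall m).2 (hall (m + 1)).1 (hall (m + 1)).2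
    exact hN p hp hp2 n hn3 κ c₁ i₁ t₁ hall hCE

/-- **Registered helper goal `noPeriodicIsolatedAtom_of_wildCones`** — the crux from the two remaining
WildCones cruxes alone: successor transport is now a THEOREM (`stub_transport stub_pairIsoKit`, crux
`ClosingReduction`'s line `chart-factorization`, landed 2026-08-17). [cite: HauserPerlega2019, §1 p. 3 and §5] -/
theorem noPeriodicIsolatedAtom_of_wildCones : NarrowRunsDie → ClassicalRegimes → NoPeriodicIsolatedAtom :=
  noPeriodicIsolatedAtom_of_engine (stub_transport stub_pairIsoKit)

end Summit.ResolutionOfSingularities.ResolutionOfSingularities.Theorems.FrobeniusClosing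

end
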